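import Literature.Analysis.FluidPDE.PeriodicCylinderWordNorms
import HarnessLib

/-!
# The Leibniz formula for words of derivatives within the closed cylinder

Topic `Literature/Analysis/FluidPDE`. Support file (all results proved, no named facts). For a word
`W = [V₁, …, V_m]` of smooth vector fields and `φ`, `f` smooth on the closed cylinder `{r ≤ 1}`,
the iterated derivative within the closed cylinder of the product is the sum over the `2^m` ways of
distributing the letters,

  `X_W (φ f) = Σ_{μ : Fin m → Bool} (X_{W|μ} φ) (X_{W|¬μ} f)`  on `{r ≤ 1}`,

where `W|μ` is the sub-word of the letters selected by the mask (in the same order)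
(`cylWord_smul_eq_sum_masks`); hence the pointwise bound
`‖X_W (φ f)‖ ≤ Σ_μ ‖X_{W|μ} φ‖ ‖X_{W|¬μ} f‖` (`norm_cylWord_smul_le_sum_masks`). This is the general-order
Leibniz rule behind the all-order product and commutator estimates in `H^k` of the period cell
(for the order `≤ 3` the tree unrolls it by hand in `Ferrari1993MoserInequality`). Folklore.

* `maskSel W μ` — the sub-word selected by a Boolean mask; `mem_of_mem_maskSel`, `maskSel_ofFn_cons_*`.

Mathlib/tree search: `cylDeriv_smul`, `cylDeriv_finset_sum`, `cylWord_congr`, `sum_fin_succ_fun`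
(tree); Mathlib's `iteratedFDeriv` Leibniz (`norm_iteratedFDerivWithin_mul_le`) is for the full
symmetric derivative, not for words of vector fields.

## References

* T. Kato, C. Y. Lai, J. Funct. Anal. 56 (1984) 15–28, §4 (estimates (4.6)–(4.7)). [KatoLai1984]
-/

noncomputable section

open Set Function
open scoped ContDiff

namespace Literature.Analysis.FluidPDE

/-- Local notation for physical space `ℝ³ = EuclideanSpace ℝ (Fin 3)`. -/
local notation "ℝ³" => EuclideanSpace ℝ (Fin 3)

/-- Local notation for the closed unit cylinder `{r ≤ 1}`. -/
local notation "𝕂" => closure (SetLike.coe unitCylinder : Set (EuclideanSpace ℝ (Fin 3)))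

variable {F : Type*} [NormedAddCommGroup F] [NormedSpace ℝ F]

/-! ### Sub-words selected by a mask -/

/-- The sub-word of the letters of `W` selected by the Boolean mask `μ` (same order; a mask shorter
than the word drops the remaining letters). [folklore] -/
def maskSel {α : Type*} : List α → List Bool → List α
  | [], _ => []
  | _ :: _, [] => []
  | a :: l, b :: μ => (if b then [a] else []) ++ maskSel l μ

/-- The empty word has no sub-words but the empty one. [folklore] -/
@[simp] theorem maskSel_nil {α : Type*} (μ : List Bool) : maskSel ([] : List α) μ = [] := rfl

/-- A selected first letter. [folklore] -/
@[simp] theorem maskSel_cons_true {α : Type*} (a : α) (l : List α) (μ : List Bool) :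
    maskSel (a :: l) (true :: μ) = a :: maskSel l μ := rfl

/-- A dropped first letter. [folklore] -/
@[simp] theorem maskSel_cons_false {α : Type*} (a : α) (l : List α) (μ : List Bool) :
    maskSel (a :: l) (false :: μ) = maskSel l μ := rfl

/-- A selected letter is a letter. [folklore] -/
theorem mem_of_mem_maskSel {α : Type*} : ∀ (l : List α) (μ : List Bool) {a : α}, a ∈ maskSel l μ → a ∈ l
  | [], _, _, h => by simp at h
  | _ :: _, [], _, h => by simp [maskSel] at h
  | b :: l, c :: μ, a, h => by
    cases c
    · exact List.mem_cons_of_mem _ (mem_of_mem_maskSel l μ (by simpa using h))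
    · rcases List.mem_cons.1 (by simpa using h) with h | h
      · exact h ▸ List.mem_cons_self
      · exact List.mem_cons_of_mem _ (mem_of_mem_maskSel l μ h)

/-- The masks of a word with one more letter: the new letter selected. [folklore] -/
theorem maskSel_ofFn_cons {α : Type*} (a : α) (l : List α) {n : ℕ} (b : Bool) (μ : Fin n → Bool) :
    maskSel (a :: l) (List.ofFn (Fin.cons b μ : Fin (n + 1) → Bool)) =
      (if b then [a] else []) ++ maskSel l (List.ofFn μ) := by
  rw [List.ofFn_succ]
  simp only [Fin.cons_zero, Fin.cons_succ]
  cases b <;> rfl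

/-- Complementing a mask commutes with `Fin.cons`. [folklore] -/
theorem not_fin_cons {n : ℕ} (b : Bool) (μ : Fin n → Bool) :
    (fun i => !(Fin.cons b μ : Fin (n + 1) → Bool) i) = Fin.cons (!b) fun i => !μ i := by
  funext i
  refine Fin.cases ?_ (fun j => ?_) i
  · simp
  · simp

/-! ### The Leibniz formula -/

/-- Words of smooth fields selected by a mask are words of smooth fields. [folklore] -/
theorem contDiff_of_mem_maskSel {Ws : List (ℝ³ → ℝ³)} (hWs : ∀ V ∈ Ws, ContDiff ℝ ∞ V) (μ : List Bool) :
    ∀ V ∈ maskSel Ws μ, ContDiff ℝ ∞ V := fun V hV => hWs V (mem_of_mem_maskSel Ws μ hV)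

/-- **The Leibniz formula for words**: `X_W (φ f) = Σ_μ (X_{W|μ} φ) (X_{W|¬μ} f)` on the closed
cylinder. [folklore] -/
theorem cylWord_smul_eq_sum_masks : ∀ (Ws : List (ℝ³ → ℝ³)), (∀ V ∈ Ws, ContDiff ℝ ∞ V) →
    ∀ {φ : ℝ³ → ℝ} {f : ℝ³ → F}, ContDiffOn ℝ ∞ φ 𝕂 → ContDiffOn ℝ ∞ f 𝕂 →
      EqOn (cylWord Ws (fun x => φ x • f x))
        (fun x => ∑ μ : Fin Ws.length → Bool,
          cylWord (maskSel Ws (List.ofFn μ)) φ x • cylWord (maskSel Ws (List.ofFn fun i => !μ i)) f x) 𝕂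
  | [], _, φ, f, _, _ => by
    intro x _
    simp [cylWord_nil]
  | V :: Ws, hVs, φ, f, hφ, hf => by
    intro x hx
    have hV : ContDiff ℝ ∞ V := hVs V List.mem_cons_self
    have hWs : ∀ W ∈ Ws, ContDiff ℝ ∞ W := fun W hW => hVs W (List.mem_cons_of_mem _ hW)
    have ih := cylWord_smul_eq_sum_masks Ws hWs hφ hf
    -- smoothness of the pieces
    have hA : ∀ μ : Fin Ws.length → Bool, ContDiffOn ℝ ∞ (cylWord (maskSel Ws (List.ofFn μ)) φ) 𝕂 := fun μ =>
      contDiffOn_cylWord (contDiff_of_mem_maskSel hWs _) hφ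
    have hB : ∀ μ : Fin Ws.length → Bool, ContDiffOn ℝ ∞ (cylWord (maskSel Ws (List.ofFn fun i => !μ i)) f) 𝕂 := fun μ =>
      contDiffOn_cylWord (contDiff_of_mem_maskSel hWs _) hf
    have hAB : ∀ μ ∈ (Finset.univ : Finset (Fin Ws.length → Bool)), ContDiffOn ℝ ∞
        (fun y => cylWord (maskSel Ws (List.ofFn μ)) φ y • cylWord (maskSel Ws (List.ofFn fun i => !μ i)) f y) 𝕂 :=
      fun μ _ => (hA μ).smul (hB μ)
    -- the left-hand side
    show cylDeriv V (cylWord Ws fun x => φ x • f x) x = _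
    rw [cylDeriv_congr ih hx, cylDeriv_finset_sum _ hAB hx]
    -- the right-hand side: split the first letter of the mask
    show _ = ∑ μ : Fin (Ws.length + 1) → Bool, cylWord (maskSel (V :: Ws) (List.ofFn μ)) φ x •
      cylWord (maskSel (V :: Ws) (List.ofFn fun i => !μ i)) f x
    rw [sum_fin_succ_fun, Fintype.sum_bool]
    simp only [not_fin_cons, maskSel_ofFn_cons, Bool.not_true, Bool.not_false, if_true, Bool.false_eq_true, if_false,
      List.singleton_append, List.nil_append, cylWord_cons, ← Finset.sum_add_distrib]
    refine Finset.sum_congr rfl fun μ _ => ?_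
    rw [cylDeriv_smul (hA μ) (hB μ) hx]

/-- **The pointwise Leibniz bound for words**: `‖X_W (φ f)‖ ≤ Σ_μ ‖X_{W|μ} φ‖ ‖X_{W|¬μ} f‖` on the
closed cylinder. [folklore] -/
theorem norm_cylWord_smul_le_sum_masks (Ws : List (ℝ³ → ℝ³)) (hWs : ∀ V ∈ Ws, ContDiff ℝ ∞ V)
    {φ : ℝ³ → ℝ} {f : ℝ³ → F} (hφ : ContDiffOn ℝ ∞ φ 𝕂) (hf : ContDiffOn ℝ ∞ f 𝕂) {x : ℝ³} (hx : x ∈ 𝕂) :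
    ‖cylWord Ws (fun x => φ x • f x) x‖ ≤ ∑ μ : Fin Ws.length → Bool,
      ‖cylWord (maskSel Ws (List.ofFn μ)) φ x‖ * ‖cylWord (maskSel Ws (List.ofFn fun i => !μ i)) f x‖ := by
  rw [cylWord_smul_eq_sum_masks Ws hWs hφ hf hx]
  refine (norm_sum_le _ _).trans (Finset.sum_le_sum fun μ _ => ?_)
  rw [norm_smul]

/-- The length of a selected sub-word plus that of the complementary one is the length of the word.
[folklore] -/
theorem length_maskSel_add_map_not {α : Type*} : ∀ (l : List α) (μ : List Bool), μ.length = l.length →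
    (maskSel l μ).length + (maskSel l (μ.map fun b => !b)).length = l.length
  | [], _, _ => by simp
  | _ :: _, [], h => by simp at h
  | a :: l, b :: μ, h => by
    have ih := length_maskSel_add_map_not l μ (by simpa using h)
    cases b
    · simp only [maskSel_cons_false, List.map_cons, Bool.not_false, maskSel_cons_true, List.length_cons]
      omega
    · simp only [maskSel_cons_true, List.map_cons, Bool.not_true, maskSel_cons_false, List.length_cons]
      omega

/-- The complementary mask as a mapped list. [folklore] -/
theorem ofFn_not_eq_map {n : ℕ} (μ : Fin n → Bool) : (List.ofFn fun i => !μ i) = (List.ofFn μ).map fun b => !b := by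
  rw [List.map_ofFn]; rfl

/-- The lengths of the two selected sub-words add up to the length of the word. [folklore] -/
theorem length_maskSel_add {α : Type*} (l : List α) {n : ℕ} (μ : Fin n → Bool) (h : l.length = n) :
    (maskSel l (List.ofFn μ)).length + (maskSel l (List.ofFn fun i => !μ i)).length = l.length := by
  rw [ofFn_not_eq_map]
  exact length_maskSel_add_map_not l _ (by simp [h])

/-- The length of a selected sub-word is at most the length of the word. [folklore] -/
theorem length_maskSel_le {α : Type*} (l : List α) {n : ℕ} (μ : Fin n → Bool) (h : l.length = n) :
    (maskSel l (List.ofFn μ)).length ≤ l.length := by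
  have := length_maskSel_add l μ h; omega

end Literature.Analysis.FluidPDE
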